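/-
Copyright (c) 2026 the pub-hodgecm-mathlib formalisation cell (harness21).  Prover seat hodgecm-mathlib-K2Liu-p09 (g5): Track B «K2-LIT»,
hLiu418 = stmt-HodgeConjecture-24832; LEAD F0P6-plan (g12) RULING M-156m 2026-09-04T07:51:54Z «A7 = GK COCYCLE ROAD», file (a).
-/
import Summits.HodgeConjecture.HodgeConjecture.Theorems.K2LiuQRationalDefs        -- ★ F1 `qVar`, `IsQRational`, `IsQRationalRegularAt` + closure
import Summits.HodgeConjecture.HodgeConjecture.Theorems.K2LiuLocalLFactorDefs     -- ★ T1 `unramValue`, `lFactor`, `chiF`, `chiNorm`, `lF`, `lEN`, `gkFactor`, `bDen`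
import Literature.NumberTheory.Automorphic.AdicCompletionResidueCard              -- ★ `residueFieldCard_adicCompletion_eq : q(K_v) = v.residueCard`
import Mathlib.NumberTheory.RamificationInertia.Basic
import HarnessLib

/-!
# Crux `HLiu418`, road `K2_Liu`, organ A7-reg (RULING M-156m, GK cocycle road), file (a):
# `q^{-s}`-RATIONALITY AND REGULARITY AT `s₀` OF THE LOCAL `L`-FACTORS `L(a·s + c, μ)` AND OF `b_n(s, χ_v)`

Cell `hodgecm-mathlib`, crux item hLiu418 = `stmt-HodgeConjecture-24832`; squad K2 ∕ K2Liu; prover K2Liu-p09 (g5).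
THEOREMS ONLY (no `def`, no instance, no notation, no named-fact hypothesis, no `sorry`); lane `--supports stmt-HodgeConjecture-24832`
(count-neutral helper).  This is «the missing F1 lemma» of the A7 census (`K2/K2Liu-p09/g5/REPORT-FIRST-A7-BadPlaceRegularity.K2Liu-p09-g5.md`
§4) filed as its own module so that ★ F1 `K2LiuQRationalDefs` and ★ T1 `K2LiuLocalLFactorDefs` stay frozen and both the (A4′)-side D-files
(K2Liu-p03 (g6)) and A7's assembly B7 `K2LiuA7NormalisedRegularity` import the same lemmas.

CONTENTS.
* §1 (generic, base `q`): affine substitution `s ↦ φ(a·s + c)` (`qVar q (a s + c) = qVar q c · (qVar q s)^a`), change of base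
  `q^f ↦ q` (`qVar (q^f) s = (qVar q s)^f`), Laurent monomials `(q^{-s})^j`, `j ∈ ℤ`.
* §2 (one finite place `w` of a number field `K`): a unitary `μ : K_wˣ →* ℂˣ` has `‖unramValue μ‖ ≤ 1`; for such `μ` the local factor
  `z ↦ L(z, μ) = (1 − unramValue μ · q_w^{−z})⁻¹` is `q_w^{-s}`-rational and REGULAR (and non-zero) at every `z₀` with `0 < re z₀`,
  hence `s ↦ L(a s + c, μ)` is regular at `s₀` whenever `0 < re (a s₀ + c)`.
* §3 (a finite place `v` of `F` in the quadratic extension `E/F`): `q_w = q_v^{f(w|v)}` for `w ∣ v`, so everything above is also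
  `q_v^{-s}`-rational; unitarity of the local components `χ_v = (χ_w)_{w∣v}` passes to `χ_{F,v}` (★ `chiF`) and to the norm twists
  (★ `chiNorm`); consequently `s ↦ L_F(a s + c, χ_F)`, `s ↦ L_{E/F}(a s + c, χ_F∘N)`, the Gindikin–Karpelevich factors `gkFactor j`
  and, at `s₀ = ½`, `s ↦ L_F(2s + k, χ_F)` (`k ∈ ℕ`) and **`s ↦ b_n(s, χ_v)`** are regular — the regularity half of
  `Fn = vol⁻¹ · b_2 · L_F(2s+1,χ_F) · L_F(2s,χ_F) · E` in A7-reg (the entire factor `E` is B5–B7's business).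
The unitarity binder `hχ : ∀ w x, ‖χ_w x‖ = 1` is ⟦R-χ⟧ of RULING M-156m (without it `b_2` may have a pole at `½`: `χ_F(ϖ) = q³`).
HONEST LABEL.  `HC_CM` is proved only modulo the 7 printed citations (2 remaining named inputs: hLiu418 = `stmt-HodgeConjecture-24832`,
h413 = `stmt-HodgeConjecture-24833`) until rung 0 closes.

## References
* [Tate1950] J. Tate, *Fourier analysis in number fields and Hecke's zeta-functions* (1950), §2.5 (local factors `(1 − μ(ϖ)q^{-s})⁻¹`).
* [Casselman1980] W. Casselman, *The unramified principal series of p-adic groups I*, Compositio Math. 40 (1980), §3 (rationality in `q^{-s}`).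
* [HarrisKudlaSweet1996] M. Harris, S. Kudla, W. J. Sweet, J. Amer. Math. Soc. 9 (1996), §6 (6.14)–(6.16) (`a_n`, `b_n`).
* [KudlaSweet1997] S. Kudla, W. J. Sweet, Israel J. Math. 98 (1997), §1 (the normalised operator, poles of `b_n`).
* [NeukirchANT1999] J. Neukirch, *Algebraic Number Theory* (1999), Ch. I §8, Ch. II Prop. (6.2) (`q_w = q_v^{f}`).
-/

set_option autoImplicit false
set_option linter.dupNamespace false -- the mandated namespace repeats `HodgeConjecture.HodgeConjecture`

noncomputable section

open Polynomial NumberField IsDedekindDomain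
open Literature.NumberTheory.GaloisRepresentations Literature.NumberTheory.GaloisRepresentations.IsNonarchimedeanLocalField
open Literature.NumberTheory.Automorphic Literature.NumberTheory.Automorphic.UnitaryGroup
open Summit.HodgeConjecture.HodgeConjecture.Cruxes.HLiu418.K2LiuQRationalDefs
open Summit.HodgeConjecture.HodgeConjecture.Cruxes.HLiu418.K2LiuLocalLFactorDefs

namespace Summit.HodgeConjecture.HodgeConjecture.Cruxes.HLiu418.K2LiuQRationalLFactor

/-! ## §1 Generic: affine substitution, change of base, Laurent monomials -/

section Generic

variable {q : ℕ} {s₀ : ℂ} {φ : ℂ → ℂ}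

/-- `q^{-(a s + c)} = q^{-c} · (q^{-s})^a` for `a ∈ ℕ`. [cite: Casselman1980, §3] -/
theorem qVar_natMul_add (hq : q ≠ 0) (a : ℕ) (c s : ℂ) : qVar q ((a : ℂ) * s + c) = qVar q c * qVar q s ^ a := by
  rw [qVar_add hq, qVar_natCast_mul, mul_comm]

/-- the substitution polynomial `R = C (q^{-c}) · X^a` evaluates to `q^{-(a s + c)}` at `X = q^{-s}`. [cite: Casselman1980, §3] -/
theorem eval_affineSubst (hq : q ≠ 0) (a : ℕ) (c s : ℂ) :
    (C (qVar q c) * X ^ a : ℂ[X]).eval (qVar q s) = qVar q ((a : ℂ) * s + c) := by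
  rw [eval_mul, eval_C, eval_pow, eval_X, qVar_natMul_add hq]

/-- **Affine substitution**: if `φ` is regular at `a s₀ + c` then `s ↦ φ (a s + c)` is regular at `s₀` (`a ∈ ℕ`, `c ∈ ℂ`).
[cite: Casselman1980, §3] -/
theorem _root_.Summit.HodgeConjecture.HodgeConjecture.Cruxes.HLiu418.K2LiuQRationalDefs.IsQRationalRegularAt.comp_affine
    (hq : q ≠ 0) (a : ℕ) (c : ℂ) (hφ : IsQRationalRegularAt q ((a : ℂ) * s₀ + c) φ) :
    IsQRationalRegularAt q s₀ fun s => φ ((a : ℂ) * s + c) := by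
  obtain ⟨P, Q, hQ, h⟩ := hφ
  refine ⟨P.comp (C (qVar q c) * X ^ a), Q.comp (C (qVar q c) * X ^ a), ?_, fun s hs => ?_⟩
  · rwa [eval_comp, eval_affineSubst hq]
  · rw [eval_comp, eval_affineSubst hq] at hs
    rw [eval_comp, eval_comp, eval_affineSubst hq]
    exact h _ hs

/-- **Affine substitution** (rational version). [cite: Casselman1980, §3] -/
theorem _root_.Summit.HodgeConjecture.HodgeConjecture.Cruxes.HLiu418.K2LiuQRationalDefs.IsQRational.comp_affine
    (hq : q ≠ 0) (a : ℕ) (ha : a ≠ 0) (c : ℂ) (hφ : IsQRational q φ) :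
    IsQRational q fun s => φ ((a : ℂ) * s + c) := by
  obtain ⟨P, Q, hQ, h⟩ := hφ
  refine ⟨P.comp (C (qVar q c) * X ^ a), Q.comp (C (qVar q c) * X ^ a), ?_, fun s hs => ?_⟩
  · intro h0
    have hdeg : (C (qVar q c) * X ^ a : ℂ[X]).natDegree = a := by
      rw [natDegree_C_mul (qVar_ne_zero hq c), natDegree_X_pow]
    have := congrArg natDegree h0
    rw [natDegree_comp, hdeg, natDegree_zero, mul_eq_zero] at this
    rcases this with hQd | ha0
    · -- `Q` is a non-zero constant: then `Q.comp R = Q ≠ 0`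
      obtain ⟨x, hx⟩ := natDegree_eq_zero.1 hQd
      apply hQ
      rw [← hx] at h0 ⊢
      rwa [C_comp] at h0
    · exact ha ha0
  · rw [eval_comp, eval_affineSubst hq] at hs
    rw [eval_comp, eval_comp, eval_affineSubst hq]
    exact h _ hs

/-- `(q^f)^{-s} = (q^{-s})^f`. [cite: NeukirchANT1999, Ch. II Prop. (6.2)] -/
theorem qVar_pow_base (q f : ℕ) (s : ℂ) : qVar (q ^ f) s = qVar q s ^ f := by
  rw [qVar_def, qVar_def, Nat.cast_pow, ← Complex.natCast_cpow_natCast_mul, Complex.cpow_nat_mul]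

/-- **Change of base**: a function rational in `(q^f)^{-s}` and regular at `s₀` is rational in `q^{-s}` and regular at `s₀`.
[cite: NeukirchANT1999, Ch. II Prop. (6.2)] -/
theorem _root_.Summit.HodgeConjecture.HodgeConjecture.Cruxes.HLiu418.K2LiuQRationalDefs.IsQRationalRegularAt.of_base_pow
    {f : ℕ} (hφ : IsQRationalRegularAt (q ^ f) s₀ φ) : IsQRationalRegularAt q s₀ φ := by
  obtain ⟨P, Q, hQ, h⟩ := hφ
  refine ⟨P.comp (X ^ f), Q.comp (X ^ f), ?_, fun s hs => ?_⟩
  · rwa [eval_comp, eval_pow, eval_X, ← qVar_pow_base]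
  · rw [eval_comp, eval_pow, eval_X, ← qVar_pow_base] at hs
    rw [eval_comp, eval_comp, eval_pow, eval_X, ← qVar_pow_base]
    exact h s hs

/-- **Laurent monomials** `(q^{-s})^j`, `j ∈ ℤ`, are regular everywhere (`q ≠ 0`). [cite: Casselman1980, §3] -/
theorem isQRationalRegularAt_qVar_zpow (hq : q ≠ 0) (s₀ : ℂ) (j : ℤ) : IsQRationalRegularAt q s₀ fun s => qVar q s ^ j := by
  obtain ⟨k, rfl | rfl⟩ := j.eq_nat_or_neg
  · simpa using isQRationalRegularAt_qVar_pow q s₀ k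
  · have h := (isQRationalRegularAt_qVar_pow q s₀ k).inv (pow_ne_zero k (qVar_ne_zero hq s₀))
    refine h.congr fun s => ?_
    simp only [zpow_neg, zpow_natCast]

/-- `(q^{-s})⁻¹ = q^{s}` is regular everywhere (`q ≠ 0`). [cite: Casselman1980, §3] -/
theorem isQRationalRegularAt_qVar_inv (hq : q ≠ 0) (s₀ : ℂ) : IsQRationalRegularAt q s₀ fun s => (qVar q s)⁻¹ := by
  simpa using isQRationalRegularAt_qVar_zpow hq s₀ (-1)

end Generic

/-! ## §2 One finite place: unitary characters, `L(z, μ)` regular and non-zero on `0 < re z` -/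

section LocalField

variable {K : Type} [Field K] [NumberField K] {w : HeightOneSpectrum (𝓞 K)}

/-- a unitary character has Satake value of norm `≤ 1` (`= 1` if unramified, `0` if ramified). [cite: Tate1950, §2.5] -/
theorem norm_unramValue_le_one {μ : (w.adicCompletion K)ˣ →* ℂˣ} (hμ : ∀ x, ‖((μ x : ℂˣ) : ℂ)‖ = 1) :
    ‖unramValue K w μ‖ ≤ 1 := by
  classical
  by_cases h : IsUnramifiedChar μ
  · rw [unramValue, if_pos h, hμ]
  · rw [unramValue_of_not K w h, norm_zero]
    exact zero_le_one

/-- `1 < q_w` as a real number. [cite: NeukirchANT1999, Ch. II Prop. (6.2)] -/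
theorem one_lt_residueFieldCard_real : (1 : ℝ) < (residueFieldCard (w.adicCompletion K) : ℝ) := by
  exact_mod_cast one_lt_residueFieldCard (w.adicCompletion K)

/-- `‖u · q^{-z}‖ < 1` for `‖u‖ ≤ 1`, `0 < re z`, `q > 1`. [cite: Tate1950, §2.5] -/
theorem norm_mul_qVar_lt_one {q : ℕ} (hq : 1 < q) {u : ℂ} (hu : ‖u‖ ≤ 1) {z : ℂ} (hz : 0 < z.re) :
    ‖u * qVar q z‖ < 1 := by
  have hq0 : (0 : ℝ) < q := by exact_mod_cast (zero_lt_one.trans hq)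
  have hq1 : (1 : ℝ) < q := by exact_mod_cast hq
  rw [norm_mul, qVar_def, Complex.norm_natCast_cpow_of_pos (zero_lt_one.trans hq), Complex.neg_re]
  have hlt : (q : ℝ) ^ (-z.re) < 1 := Real.rpow_lt_one_of_one_lt_of_neg hq1 (by linarith)
  calc ‖u‖ * (q : ℝ) ^ (-z.re) ≤ 1 * (q : ℝ) ^ (-z.re) := by gcongr
    _ < 1 := by rw [one_mul]; exact hlt

/-- `1 − u · q^{-z} ≠ 0` for `‖u‖ ≤ 1`, `0 < re z`, `q > 1`. [cite: Tate1950, §2.5] -/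
theorem one_sub_mul_qVar_ne_zero {q : ℕ} (hq : 1 < q) {u : ℂ} (hu : ‖u‖ ≤ 1) {z : ℂ} (hz : 0 < z.re) :
    1 - u * qVar q z ≠ 0 := by
  intro h
  have : ‖u * qVar q z‖ = 1 := by rw [← sub_eq_zero.1 h, norm_one]
  exact (norm_mul_qVar_lt_one hq hu hz).ne this

/-- **`z ↦ L(z, μ)` is `q_w^{-s}`-rational and regular at every `z₀` with `0 < re z₀`** when `‖unramValue μ‖ ≤ 1` (in particular
for unitary `μ`, or for ramified `μ` where `L = 1`). [cite: Tate1950, §2.5] [cite: KudlaSweet1997, §1] -/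
theorem isQRationalRegularAt_lFactor {μ : (w.adicCompletion K)ˣ →* ℂˣ} (hu : ‖unramValue K w μ‖ ≤ 1) {z₀ : ℂ} (hz : 0 < z₀.re) :
    IsQRationalRegularAt (residueFieldCard (w.adicCompletion K)) z₀ (lFactor K w μ) := by
  refine ⟨1, C 1 - C (unramValue K w μ) * X, ?_, fun z hz' => ?_⟩
  · rw [eval_sub, eval_C, eval_mul, eval_C, eval_X]
    exact one_sub_mul_qVar_ne_zero (one_lt_residueFieldCard _) hu hz
  · rw [eval_one, eval_sub, eval_C, eval_mul, eval_C, eval_X, lFactor_def, qVar_def, one_div]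

/-- `L(z₀, μ) ≠ 0` (it is the inverse of a non-zero number) when `‖unramValue μ‖ ≤ 1`, `0 < re z₀`. [cite: Tate1950, §2.5] -/
theorem lFactor_ne_zero {μ : (w.adicCompletion K)ˣ →* ℂˣ} (hu : ‖unramValue K w μ‖ ≤ 1) {z₀ : ℂ} (hz : 0 < z₀.re) :
    lFactor K w μ z₀ ≠ 0 := by
  rw [lFactor_def]
  exact inv_ne_zero (by simpa only [qVar_def] using one_sub_mul_qVar_ne_zero (one_lt_residueFieldCard _) hu hz)

/-- **`s ↦ L(a s + c, μ)` is regular at `s₀`** when `0 < re (a s₀ + c)` (`a ∈ ℕ`, `c ∈ ℂ`) and `‖unramValue μ‖ ≤ 1`.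
[cite: Tate1950, §2.5] [cite: KudlaSweet1997, §1] -/
theorem isQRationalRegularAt_lFactor_affine {μ : (w.adicCompletion K)ˣ →* ℂˣ} (hu : ‖unramValue K w μ‖ ≤ 1) (a : ℕ) (c : ℂ)
    {s₀ : ℂ} (hz : 0 < ((a : ℂ) * s₀ + c).re) :
    IsQRationalRegularAt (residueFieldCard (w.adicCompletion K)) s₀ fun s => lFactor K w μ ((a : ℂ) * s + c) :=
  (isQRationalRegularAt_lFactor hu hz).comp_affine (residueFieldCard_ne_zero _) a c

end LocalField

/-! ## §3 A place `v` of `F` in `E/F`: `q_w = q_v^f`, unitarity of `χ_F` and of the norm twists, `L_F`, `L_{E/F}`, `gkFactor`, `b_n` -/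

section Quadratic

variable {F : Type} [Field F] [NumberField F] {E : Type} [Field E] [NumberField E] [Algebra F E]
  (c : E ≃ₐ[F] E) {v : HeightOneSpectrum (𝓞 F)}

/-- `#κ(w) = #κ(v)^{f(w|v)}` for `w ∣ v` (Mathlib `Ideal.inertiaDeg_eq_of_isMaximal` and `Module.natCard_eq_pow_finrank`; a copy of the
private lemma of ★ `BaseChangeStrongUnramifiedUnitaryReduction`, repeated to keep this file's imports light). [cite: NeukirchANT1999, Ch. I §8] -/
private theorem residueCard_eq_pow_inertiaDeg_of_under_eq' {w : HeightOneSpectrum (𝓞 E)} (hw : w.asIdeal.under (𝓞 F) = v.asIdeal) :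
    w.residueCard = v.residueCard ^ w.asIdeal.inertiaDeg (𝓞 F) := by
  rw [HeightOneSpectrum.residueCard_eq_card_quotient, HeightOneSpectrum.residueCard_eq_card_quotient]
  haveI : w.asIdeal.IsMaximal := w.isMaximal
  haveI : v.asIdeal.IsMaximal := v.isMaximal
  haveI : w.asIdeal.LiesOver v.asIdeal := ⟨hw.symm⟩
  letI : Field (𝓞 F ⧸ v.asIdeal) := Ideal.Quotient.field _
  rw [Ideal.inertiaDeg_eq_of_isMaximal v.asIdeal w.asIdeal, Module.natCard_eq_pow_finrank (K := 𝓞 F ⧸ v.asIdeal)]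

/-- **`q_w = q_v^{f(w|v)}`** for the completions at `w ∣ v`. [cite: NeukirchANT1999, Ch. II Prop. (6.2)] -/
theorem residueFieldCard_placesOver_eq_pow (w : PlacesOver E v) :
    residueFieldCard (w.1.adicCompletion E) = residueFieldCard (v.adicCompletion F) ^ w.1.asIdeal.inertiaDeg (𝓞 F) := by
  rw [residueFieldCard_adicCompletion_eq, residueFieldCard_adicCompletion_eq]
  have hw : w.1.asIdeal.under (𝓞 F) = v.asIdeal := by
    have h := congrArg HeightOneSpectrum.asIdeal w.2
    rwa [HeightOneSpectrum.under_asIdeal] at h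
  exact residueCard_eq_pow_inertiaDeg_of_under_eq' hw

/-- at `w ∣ v`, a `q_w^{-s}`-rational function regular at `s₀` is `q_v^{-s}`-rational and regular at `s₀`. [cite: NeukirchANT1999, Ch. II Prop. (6.2)] -/
theorem isQRationalRegularAt_of_placesOver (w : PlacesOver E v) {s₀ : ℂ} {φ : ℂ → ℂ}
    (hφ : IsQRationalRegularAt (residueFieldCard (w.1.adicCompletion E)) s₀ φ) :
    IsQRationalRegularAt (residueFieldCard (v.adicCompletion F)) s₀ φ := by
  rw [residueFieldCard_placesOver_eq_pow] at hφ
  exact hφ.of_base_pow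

variable {c}

/-- unitarity of the local components passes to `χ_{F,v} = Π_w χ_w ∘ ι_w`. [cite: HarrisKudlaSweet1996, §6 (6.14)] -/
theorem norm_chiF_eq_one {χv : ∀ w : PlacesOver E v, (w.1.adicCompletion E)ˣ →* ℂˣ}
    (hχ : ∀ (w : PlacesOver E v) (x : (w.1.adicCompletion E)ˣ), ‖((χv w x : ℂˣ) : ℂ)‖ = 1) (x : (v.adicCompletion F)ˣ) :
    ‖((chiF F E v χv x : ℂˣ) : ℂ)‖ = 1 := by
  rw [chiF_apply, Units.coe_prod, norm_prod]
  exact Finset.prod_eq_one fun w _ => hχ w _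

/-- unitarity passes to the norm twists `χ_w · (χ_{cw} ∘ c)`. [cite: HarrisKudlaSweet1996, §6 (6.16)] -/
theorem norm_chiNorm_eq_one {χv : ∀ w : PlacesOver E v, (w.1.adicCompletion E)ˣ →* ℂˣ}
    (hχ : ∀ (w : PlacesOver E v) (x : (w.1.adicCompletion E)ˣ), ‖((χv w x : ℂˣ) : ℂ)‖ = 1) (w : PlacesOver E v)
    (x : (w.1.adicCompletion E)ˣ) : ‖((chiNorm F E c v χv w x : ℂˣ) : ℂ)‖ = 1 := by
  rw [chiNorm_apply, Units.val_mul, norm_mul, hχ, hχ, mul_one]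

variable (c)

/-- **`s ↦ L_F(a s + c₀, χ_{F,v})` is regular at `s₀`** when `0 < re (a s₀ + c₀)` and `χ_v` is unitary. [cite: Tate1950, §2.5] [cite: KudlaSweet1997, §1] -/
theorem isQRationalRegularAt_lF_affine {χv : ∀ w : PlacesOver E v, (w.1.adicCompletion E)ˣ →* ℂˣ}
    (hχ : ∀ (w : PlacesOver E v) (x : (w.1.adicCompletion E)ˣ), ‖((χv w x : ℂˣ) : ℂ)‖ = 1) (a : ℕ) (c₀ : ℂ) {s₀ : ℂ}
    (hz : 0 < ((a : ℂ) * s₀ + c₀).re) :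
    IsQRationalRegularAt (residueFieldCard (v.adicCompletion F)) s₀ fun s => lF F E v χv ((a : ℂ) * s + c₀) :=
  isQRationalRegularAt_lFactor_affine (norm_unramValue_le_one (norm_chiF_eq_one hχ)) a c₀ hz

/-- `L_F(z₀, χ_{F,v}) ≠ 0` for `0 < re z₀` and unitary `χ_v`. [cite: Tate1950, §2.5] -/
theorem lF_ne_zero {χv : ∀ w : PlacesOver E v, (w.1.adicCompletion E)ˣ →* ℂˣ}
    (hχ : ∀ (w : PlacesOver E v) (x : (w.1.adicCompletion E)ˣ), ‖((χv w x : ℂˣ) : ℂ)‖ = 1) {z₀ : ℂ} (hz : 0 < z₀.re) :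
    lF F E v χv z₀ ≠ 0 :=
  lFactor_ne_zero (norm_unramValue_le_one (norm_chiF_eq_one hχ)) hz

/-- **`s ↦ L_{E/F,v}(a s + c₀, χ_F ∘ N) = Π_{w∣v} L_{E_w}(a s + c₀, χ_w·(χ_{cw}∘c))` is regular at `s₀`** when `0 < re (a s₀ + c₀)` and
`χ_v` is unitary (base `q_v`: each factor is `q_w^{-s}`-rational with `q_w = q_v^{f}`). [cite: HarrisKudlaSweet1996, §6 (6.16)] [cite: Tate1950, §2.5] -/
theorem isQRationalRegularAt_lEN_affine {χv : ∀ w : PlacesOver E v, (w.1.adicCompletion E)ˣ →* ℂˣ}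
    (hχ : ∀ (w : PlacesOver E v) (x : (w.1.adicCompletion E)ˣ), ‖((χv w x : ℂˣ) : ℂ)‖ = 1) (a : ℕ) (c₀ : ℂ) {s₀ : ℂ}
    (hz : 0 < ((a : ℂ) * s₀ + c₀).re) :
    IsQRationalRegularAt (residueFieldCard (v.adicCompletion F)) s₀ fun s => lEN F E c v χv ((a : ℂ) * s + c₀) := by
  unfold lEN
  refine IsQRationalRegularAt.prod _ fun w _ => isQRationalRegularAt_of_placesOver w ?_
  exact isQRationalRegularAt_lFactor_affine (norm_unramValue_le_one (norm_chiNorm_eq_one hχ w)) a c₀ hz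

/-- **`s ↦ gkFactor j (a s + c₀)` (`= L_F(a s + c₀, χ_F η^j)`, written `η`-free) is regular at `s₀`** when `0 < re (a s₀ + c₀)` and `χ_v`
is unitary. [cite: HarrisKudlaSweet1996, §6 (6.16)] [cite: KudlaSweet1997, §1] -/
theorem isQRationalRegularAt_gkFactor_affine {χv : ∀ w : PlacesOver E v, (w.1.adicCompletion E)ˣ →* ℂˣ}
    (hχ : ∀ (w : PlacesOver E v) (x : (w.1.adicCompletion E)ˣ), ‖((χv w x : ℂˣ) : ℂ)‖ = 1) (j a : ℕ) (c₀ : ℂ) {s₀ : ℂ}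
    (hz : 0 < ((a : ℂ) * s₀ + c₀).re) :
    IsQRationalRegularAt (residueFieldCard (v.adicCompletion F)) s₀ fun s => gkFactor F E c v χv j ((a : ℂ) * s + c₀) := by
  rcases Nat.even_or_odd j with hj | hj
  · simp only [gkFactor_of_even F E c v χv hj]
    exact isQRationalRegularAt_lF_affine hχ a c₀ hz
  · simp only [gkFactor_of_odd F E c v χv hj]
    exact (isQRationalRegularAt_lEN_affine c hχ a c₀ hz).div (isQRationalRegularAt_lF_affine hχ a c₀ hz) (lF_ne_zero hχ hz)

/-- **`s ↦ L_F(2s + k, χ_{F,v})` is regular at `½`** for every `k ∈ ℕ` and unitary `χ_v` (`re(2·½ + k) = 1 + k > 0`) — the factors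
`L_F(2s+1, χ_F)`, `L_F(2s, χ_F)` of A7-reg's `Fn`. [cite: KudlaSweet1997, §1] [cite: Tate1950, §2.5] -/
theorem isQRationalRegularAt_lF_two_mul_add_nat {χv : ∀ w : PlacesOver E v, (w.1.adicCompletion E)ˣ →* ℂˣ}
    (hχ : ∀ (w : PlacesOver E v) (x : (w.1.adicCompletion E)ˣ), ‖((χv w x : ℂˣ) : ℂ)‖ = 1) (k : ℕ) :
    IsQRationalRegularAt (residueFieldCard (v.adicCompletion F)) (1 / 2) fun s => lF F E v χv (2 * s + k) := by
  have h := isQRationalRegularAt_lF_affine (v := v) hχ 2 (k : ℂ) (s₀ := 1 / 2)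
    (by simp only [Nat.cast_ofNat, Complex.add_re, Complex.mul_re, Complex.natCast_re]; norm_num; positivity)
  simpa only [Nat.cast_ofNat] using h

/-- **`s ↦ b_n(s, χ_v) = Π_{j<n} L_F(2s + n − j, χ_F η^j)` is regular at `½`** for unitary `χ_v` (each argument has real part
`1 + n − j ≥ 2` at `s = ½`) — the `b_2` of A7-reg's `Fn = vol⁻¹ · b_2 · L_F(2s+1,χ_F) · L_F(2s,χ_F) · E`.
[cite: KudlaSweet1997, §1] [cite: HarrisKudlaSweet1996, §6 (6.16)] -/
theorem isQRationalRegularAt_bDen_half {χv : ∀ w : PlacesOver E v, (w.1.adicCompletion E)ˣ →* ℂˣ}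
    (hχ : ∀ (w : PlacesOver E v) (x : (w.1.adicCompletion E)ˣ), ‖((χv w x : ℂˣ) : ℂ)‖ = 1) (n : ℕ) :
    IsQRationalRegularAt (residueFieldCard (v.adicCompletion F)) (1 / 2) (bDen F E c v n χv) := by
  have h : IsQRationalRegularAt (residueFieldCard (v.adicCompletion F)) (1 / 2)
      fun s => ∏ j ∈ Finset.range n, gkFactor F E c v χv j ((2 : ℕ) * s + ((n : ℂ) - (j : ℂ))) := by
    refine IsQRationalRegularAt.prod _ fun j hj => isQRationalRegularAt_gkFactor_affine c hχ j 2 _ ?_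
    have hjn : (j : ℝ) < n := by exact_mod_cast Finset.mem_range.1 hj
    simp only [Nat.cast_ofNat, Complex.add_re, Complex.sub_re, Complex.mul_re, Complex.natCast_re]
    norm_num
    linarith
  refine h.congr fun s => ?_
  simp only [bDen, Nat.cast_ofNat]
  refine Finset.prod_congr rfl fun j _ => ?_
  ring_nf

end Quadratic

end Summit.HodgeConjecture.HodgeConjecture.Cruxes.HLiu418.K2LiuQRationalLFactor

end
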